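/- Copyright: the b2b-balaban cell (near-miss cell 7), T⁴-continuum fan-out, lineage t4-ne7b-formalise-leaf-06 (NE7b CRUX
TEAM (2) leaf prover 06), gen 32: «THE ROUNDING WINDOW», file 1∕3.  Released under the licence of the surrounding project. -/
import Summits.QuantumFields.BalabanUV.T4Continuum.Support.HistoryBankingDiscountCharge

/-!
# History banking, M5-3 (γ′) file 1∕3: PRINT'S SHARP EXPONENT LETTERS and THE SHARE ENVELOPE — the three displayed
discount shares of `HistoryBankingDiscountCharge` against ONE size letter (route R-P1 of row NE7b; re-open object (α),
`WALL-NE7b-P1.md` v1.19 §2 row `price` ∕ §5 (o), located residue (γ′))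

Summits-side support leaf of the T⁴-continuum cell (rung (B)+1 on a FINITE torus only; NOT infinite volume, NOT the
mass gap, NOT the Clay statement; NOT a proof of the spine estimate NE7b — the cell's OWN estimate, NOT PRINTED, NOT
PROVED).  [folklore] real arithmetic over the lineage's typed share table (`HistoryBankingDiscountCharge.{dshare, mshare}`
of the OWNER t4-ne7b-p1 g45, row S21), the dictionary's windows (`T4PersistenceDictionary.{dictW, fatWait}`), the printed
shape letters (`T4PrintedShapeBanking.{Consts, wt}`, `HistoryConstants.{PrintedO1s, pcredit}`, `Setup.p0Profile`) and the
typed flow inequality (2.9) (`B14FlowStep.FlowIneq29`); no `[cite:]` tag, nothing printed asserted, no `def … : Prop`,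
zero `sorry`.

WHY.  After row S21 (M5-3, R-OWNER-45-1) the credit part of the `κ := costT` price sentence `priceM` is kernel MODULO two
located displays: `HistoryBankingCreditRead.FactorRead (fB K) (fR K) (sB K) (sR K)` (VALUES of M2 brick B's factors below
sharp exponents) and `HistoryBankingDiscountCharge.RoundingRoom C O L K (R K) (g K) (sB K) (sR K)` (print's two roundings
READ WITH ROOM), with the sharp letters `sB`, `sR` free.  WALL v1.19 §5 (o) (γ′): «for print's exponents … discharged in
arithmetic from `B16Sect1Kernels.ExponentProviso383` + the END's pay-clause family once `sB`∕`sR` are instantiated».  This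
file and its siblings `HistoryBankingRoundingWindow` ∕ `HistoryBankingRoundingSupply` DO that instantiation and that arithmetic:
HERE the letters and the K-UNIFORM share envelope; THERE the window, the two clauses, `RoundingRoom` itself, the threshold
and coupling forms, and the OWNER g46's fibre junction `RoundingRoomF` (M5-4a) at the same letters.

WHAT.  §1 letters: `ell g j = log g_j⁻²`; **`sRsharp t Ap₁ p₁ R g h = (R_h^{t})⁻¹·(Ap₁·ℓ_h^{p₁})²`** — at `t = d+5` the
exponent of the right member `exp(−R_j^{−d−5}p₁²(g_j))` of [B16] p. 383's sentence after (1.78) (`B16Sect1Kernels.lfFactor178`,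
a LOCATOR; `p₁(g) = Ap₁·(log g⁻²)^{p₁}`; size power, amplitude and exponent free); **`sBsharp O m C g j d′ = γ₀·m·p₀(g_j)²·(d′+1)`** —
the exponent of the left member of the p. 381 display (`B16LargeFieldFactors380.minConst`∕`display381`, LOCATORS) with
the min-constant a free letter `m` (the sibling's birth clause needs only `A₁² ≤ m`); the share constant **`S₀ = 48 + 12n₁ +
8(E₃∕E₂)(1+dC)`**.  §2 share arithmetic against ONE size bound `u ≥ 1` (every size the event reads `≤ u`, `L·size ≤ u`):
`fatWait d′ ≤ d′+1`, `mshare_eq` (re-derived from leaf-06 g31's X6 probe), `dshare_kind0_eq`, `dshare_kind1_eq`,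
**`mshare_le_of_size_le`** `≤ u^{q′+1}(12 + 12n₁ + 8(E₃∕E₂)dC)`, **`dshare_kind0_le_of_size_le`** `≤ (d′+1)u^{q′+1}(36 + 8E₃∕E₂)`,
**`dshare_kind1_le_of_size_le`** `≤ 24u^{q′+1}`.  §3 the envelope letter **`uEnv L r g j = L³·ℓ_j^{r}`**: (2.9)'s first member
gives `R_s ≤ L·R_j` for EVERY later performed step (`size_later_le` — the K-uniformity of `RoundingRoom.birth`'s «one merger
share at any later step», leaf-06 g31 X6 ∕ leaf-05 g30 F69 (iii)), and with the (2.5) envelope `R_j ≤ L·ℓ_j^{r}`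
(`B14FlowStep.isRj_le_mul_logpow`) every size read by a birth at `j` or its absorbing merger is `≤ uEnv` (`sizes_le_uEnv`);
`uEnv_pow`: `u^{q′+1} = L^{3(q′+1)}ℓ^{r(q′+1)}`.

HONEST SCOPE.  Real arithmetic over OUR carriers; `SharpWindow` is a HYPOTHESIS shape (a smallness of OUR letters,
reducible to `g_j ≤ γ ≤ e^{−ℓ⋆∕2}`); nothing of H3 ∕ (B) ∕ BetaPertH is discharged; what stays displayed after this file is
`FactorRead (fB K) (fR K) (sBsharp …) (sRsharp …)` (the VALUES of M2 brick B's factors below print's sharp exponents — H3's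
identification) and the window.  Nothing of Bałaban's is asserted or contested: «g_j sufficiently small» is typed as an
explicit window, nothing more.  NE7b NOT PRINTED ∕ NOT PROVED; spine 0∕9; rung (B)+1 on a FINITE torus — NOT infinite
volume, NOT the mass gap, NOT Clay.  HONEST DEPENDENCY (cell): continuum YM on T⁴ ⇐ BetaPertH ∧ nine spine estimates (0/9
proved); BetaPertH ⇐ (D1) ∧ (D4) ∧ CAP+tail; G-an2-4 gates asym, D1 and NE2/3/4.  This file changes none of it.
-/

open Finset
open Literature.MathematicalPhysics.QuantumFieldTheory.Balaban1983to89
open T4PersistenceDictionary T4PrintedShapeBanking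
open Summit.QuantumFields.BalabanUV.T4Continuum.HistoryConstants
open Summit.QuantumFields.BalabanUV.T4Continuum.HistoryBankingDiscountCharge

namespace Summit.QuantumFields.BalabanUV.T4Continuum.HistoryBankingSharpShares

noncomputable section

/-! ## §1 The letters: `ℓ_j`, print's sharp renewal ∕ birth exponents, the share constant `S₀` -/

section Letters

/-- `ℓ_j = log g_j⁻²` — the logarithm the profile `p0Profile A₀ p₀ (g_j) = A₀·ℓ_j^{p₀}` is a power of. [folklore] -/
def ell (g : ℕ → ℝ) (j : ℕ) : ℝ := Real.log ((g j) ^ 2)⁻¹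

/-- the profile in the letter `ℓ`: `p0Profile A₀ p₀ (g_j) = A₀·ℓ_j^{p₀}` (definitional). [folklore] -/
theorem p0Profile_eq (A₀ : ℝ) (p₀ : ℕ) (g : ℕ → ℝ) (j : ℕ) : p0Profile A₀ p₀ (g j) = A₀ * ell g j ^ p₀ := rfl

/-- **PRINT'S SHARP RENEWAL EXPONENT** (letter): `sRsharp t Ap₁ p₁ R g h = (R_h^{t})⁻¹·(Ap₁·ℓ_h^{p₁})²`, read for the
level-`h` 𝐑-operation with the run's size `R_h` and `p₁(g) = Ap₁·(log g⁻²)^{p₁}` — at the size power `t = d + 5` the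
exponent of the right member `exp(−R_j^{−d−5}p₁²(g_j))` of the large-field-factor sentence of [B16] p. 383 after (1.78)
(`B16Sect1Kernels.lfFactor178`, a LOCATOR — nothing of it asserted here; the instantiation of record R-OWNER-45-1 ∕ calc
G26.2); at `t = d + 3` and amplitude `Ap₁² ↦ ½γ₀A₁²Ap₁²∕(6(d+3)(100M(L+1))^{d+2})` a LOWER ENVELOPE of its UNROUNDED
left member `S_h = ½γ₀[6(d+3)(100M(L+1)N_h^{β₀}R_h)^{d+2}]⁻¹A₁²p₁²(g_h)` (refuter PRICING-NE7b v13 L-v13-1's preferred letter,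
`N_h = R_h`; `R_h^{β₀(d+2)} ≤ R_h` when `β₀(d+2) ≤ 1`, so `S_h ≥` this letter and a factor reading at `S_h` implies one
here).  Size power, amplitude and exponent are free letters; nothing of print is fixed. [folklore] -/
def sRsharp (t : ℕ) (Ap₁ : ℝ) (p₁ : ℕ) (R : ℕ → ℕ) (g : ℕ → ℝ) (h : ℕ) : ℝ :=
  ((R h : ℝ) ^ t)⁻¹ * (Ap₁ * ell g h ^ p₁) ^ 2

/-- **PRINT'S SHARP BIRTH EXPONENT** (letter): `sBsharp O m C g j d′ = γ₀·m·p₀(g_j)²·(d′+1)` — the exponent of the left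
member `exp(−γ₀ min{½B₃⁻²A₀², 2A₁², A₁²}p₀²(g_j)(d′_j + 1))` of the p. 381 display of [B16]
(`B16LargeFieldFactors380.minConst`∕`display381`, LOCATORS), with the min-constant carried as a free letter `m` (the
birth clause below needs only `A₁² ≤ m`, which is EQUALITY under the ledger relation `2B₃²A₁² ≤ A₀²` by
`B16LargeFieldFactors380.min_eq_A1sq` — sibling `HistoryBankingRoundingWindow` §3). [folklore] -/
def sBsharp (O : PrintedO1s) (m : ℝ) (C : T4PrintedShapeBanking.Consts) (g : ℕ → ℝ) (j d' : ℕ) : ℝ :=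
  O.γ₀ * m * p0Profile C.A₀ C.p₀ (g j) ^ 2 * ((d' : ℝ) + 1)

/-- **THE SHARE CONSTANT** `S₀ = 48 + 12·n₁ + 8·(E₃∕E₂)·(1 + dC)`: the coefficient of `(d′+1)·u^{q′+1}` in the bound of a
birth's own discount share plus one merger share at any later step, all sizes `≤ u` (§2). [folklore] -/
def S0 (C : T4PrintedShapeBanking.Consts) : ℝ := 48 + 12 * (C.n₁ : ℝ) + 8 * (C.E₃ / C.E₂) * (1 + (C.dC : ℝ))

variable {C : T4PrintedShapeBanking.Consts}

/-- `S₀ ≥ 0` (`E₂, E₃ ≥ 0`). [folklore] -/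
theorem S0_nonneg (hE₂ : 0 ≤ C.E₂) (hE₃ : 0 ≤ C.E₃) : 0 ≤ S0 C := by
  unfold S0; positivity

end Letters

/-! ## §2 Share arithmetic: the three displayed shares against ONE size bound `u ≥ 1` -/

section Shares

variable {C : T4PrintedShapeBanking.Consts} {L : ℕ} {R : ℕ → ℕ}

/-- the fat waiting time is at most the class plus one: `fatWait d′ = max 1 ⌊log₂ d′⌋ ≤ d′ + 1`. [folklore] -/
theorem fatWait_le_succ (d : ℕ) : fatWait d ≤ d + 1 := by
  have h := Nat.log_le_self 2 d
  unfold fatWait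
  omega

/-- the merger share as an explicit function of the size at its step (re-derived from leaf-06 g31's X6 probe on
`HistoryBankingDiscountCharge`, C-ne7bleaf06g31-6). [folklore] -/
theorem mshare_eq (C : T4PrintedShapeBanking.Consts) (L : ℕ) (R : ℕ → ℕ) (s : ℕ) :
    mshare C L R s = 8 * ((C.n₁ : ℝ) + R s) * ((L : ℝ) * R s) ^ C.q' +
      8 * (C.E₃ / C.E₂) * (((L : ℝ) * R s) ^ C.q' * (C.dC : ℝ)) + 4 * ((C.n₁ : ℝ) + R s) := by
  unfold mshare dshare
  rw [dictW_kind2 rfl, wt_kind2 rfl]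
  simp [PEv.step_mk]

/-- the discount share of a BIRTH of class `d′` at step `j` explicitly:
`8·(fatWait d′ + R_j + 1)·(L R_j)^{q′} + 8(E₃∕E₂)(L R_j)^{q′}(d′+1) + 4·(fatWait d′ + R_j + 1)`. [folklore] -/
theorem dshare_kind0_eq {e : PEv} (h : e.kind = 0) :
    dshare C L R e = 8 * ((fatWait e.fat : ℝ) + R e.step + 1) * ((L : ℝ) * R e.step) ^ C.q' +
      8 * (C.E₃ / C.E₂) * (((L : ℝ) * R e.step) ^ C.q' * ((e.fat : ℝ) + 1)) +
      4 * ((fatWait e.fat : ℝ) + R e.step + 1) := by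
  unfold dshare
  rw [dictW_kind0 h, wt_kind0 h]
  push_cast
  ring

/-- the discount share of a RENEWAL at step `s` explicitly: `8·(R_s + 1)·(L R_s)^{q′} + 4·(R_s + 1)` (a renewed
component is a small domain: size weight `0`). [folklore] -/
theorem dshare_kind1_eq {e : PEv} (h : e.kind = 1) :
    dshare C L R e = 8 * ((R e.step : ℝ) + 1) * ((L : ℝ) * R e.step) ^ C.q' + 4 * ((R e.step : ℝ) + 1) := by
  have hw : wt C e = 0 := by simp [wt, h]
  unfold dshare
  rw [dictW_kind1 h, hw]
  push_cast
  ring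

/-- **ONE MERGER SHARE AGAINST A SIZE BOUND**: if `R_s ≤ u` and `L·R_s ≤ u` with `u ≥ 1` then
`mshare C L R s ≤ u^{q′+1}·(12 + 12 n₁ + 8(E₃∕E₂)·dC)` (`E₂ > 0`, `E₃ ≥ 0`). [folklore] -/
theorem mshare_le_of_size_le (hE₂ : 0 < C.E₂) (hE₃ : 0 ≤ C.E₃) {u : ℝ} (hu : 1 ≤ u) {s : ℕ}
    (hRs : (R s : ℝ) ≤ u) (hLRs : (L : ℝ) * R s ≤ u) :
    mshare C L R s ≤ u ^ (C.q' + 1) * (12 + 12 * (C.n₁ : ℝ) + 8 * (C.E₃ / C.E₂) * (C.dC : ℝ)) := by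
  rw [mshare_eq]
  have hu0 : 0 ≤ u := by linarith
  have hn₁ : (0 : ℝ) ≤ C.n₁ := Nat.cast_nonneg _
  have hdC : (0 : ℝ) ≤ C.dC := Nat.cast_nonneg _
  have hRs0 : (0 : ℝ) ≤ R s := Nat.cast_nonneg _
  have hρ : 0 ≤ C.E₃ / C.E₂ := div_nonneg hE₃ hE₂.le
  have hp : ((L : ℝ) * R s) ^ C.q' ≤ u ^ C.q' := pow_le_pow_left₀ (by positivity) hLRs _
  have hq1 : 1 ≤ u ^ C.q' := one_le_pow₀ hu
  have hq0 : 0 ≤ u ^ C.q' := by positivity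
  have hpow : u ^ (C.q' + 1) = u ^ C.q' * u := pow_succ u C.q'
  -- term by term
  have h1 : 8 * ((C.n₁ : ℝ) + R s) * ((L : ℝ) * R s) ^ C.q' ≤ (8 * (C.n₁ : ℝ) + 8) * (u ^ C.q' * u) := by
    calc 8 * ((C.n₁ : ℝ) + R s) * ((L : ℝ) * R s) ^ C.q'
        ≤ 8 * ((C.n₁ : ℝ) + u) * u ^ C.q' := by
          apply mul_le_mul (by linarith) hp (by positivity) (by positivity)
      _ = 8 * (C.n₁ : ℝ) * u ^ C.q' + 8 * (u ^ C.q' * u) := by ring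
      _ ≤ 8 * (C.n₁ : ℝ) * (u ^ C.q' * u) + 8 * (u ^ C.q' * u) := by
          have : u ^ C.q' ≤ u ^ C.q' * u := le_mul_of_one_le_right hq0 hu
          nlinarith
      _ = (8 * (C.n₁ : ℝ) + 8) * (u ^ C.q' * u) := by ring
  have h2 : 8 * (C.E₃ / C.E₂) * (((L : ℝ) * R s) ^ C.q' * (C.dC : ℝ)) ≤
      8 * (C.E₃ / C.E₂) * (C.dC : ℝ) * (u ^ C.q' * u) := by
    have : ((L : ℝ) * R s) ^ C.q' * (C.dC : ℝ) ≤ (u ^ C.q' * u) * (C.dC : ℝ) :=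
      mul_le_mul_of_nonneg_right (hp.trans (le_mul_of_one_le_right hq0 hu)) hdC
    nlinarith
  have h3 : 4 * ((C.n₁ : ℝ) + R s) ≤ (4 * (C.n₁ : ℝ) + 4) * (u ^ C.q' * u) := by
    have hq1' : 1 ≤ u ^ C.q' * u := by nlinarith
    nlinarith
  rw [hpow]
  nlinarith

/-- **A BIRTH'S OWN SHARE AGAINST A SIZE BOUND**: for a kind-`0` event of class `d′` at step `j` with `R_j ≤ u`,
`L·R_j ≤ u`, `u ≥ 1`: `dshare C L R e ≤ (d′+1)·u^{q′+1}·(36 + 8 E₃∕E₂)` (the window `fatWait d′ + R_j + 1 ≤ 3(d′+1)u`).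
[folklore] -/
theorem dshare_kind0_le_of_size_le (hE₂ : 0 < C.E₂) (hE₃ : 0 ≤ C.E₃) {u : ℝ} (hu : 1 ≤ u) {e : PEv}
    (h : e.kind = 0) (hRj : (R e.step : ℝ) ≤ u) (hLRj : (L : ℝ) * R e.step ≤ u) :
    dshare C L R e ≤ ((e.fat : ℝ) + 1) * u ^ (C.q' + 1) * (36 + 8 * (C.E₃ / C.E₂)) := by
  rw [dshare_kind0_eq h]
  set D : ℝ := (e.fat : ℝ) + 1 with hD
  have hD1 : 1 ≤ D := by rw [hD]; have : (0 : ℝ) ≤ e.fat := Nat.cast_nonneg _; linarith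
  have hu0 : 0 ≤ u := by linarith
  have hρ : 0 ≤ C.E₃ / C.E₂ := div_nonneg hE₃ hE₂.le
  have hfw : (fatWait e.fat : ℝ) ≤ D := by
    rw [hD]; exact_mod_cast fatWait_le_succ e.fat
  have hW : (fatWait e.fat : ℝ) + R e.step + 1 ≤ 3 * D * u := by
    nlinarith [mul_nonneg (sub_nonneg.2 hD1) (sub_nonneg.2 hu)]
  have hW0 : 0 ≤ (fatWait e.fat : ℝ) + R e.step + 1 := by positivity
  have hp : ((L : ℝ) * R e.step) ^ C.q' ≤ u ^ C.q' := pow_le_pow_left₀ (by positivity) hLRj _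
  have hq1 : 1 ≤ u ^ C.q' := one_le_pow₀ hu
  have hq0 : 0 ≤ u ^ C.q' := by positivity
  have hpow : u ^ (C.q' + 1) = u ^ C.q' * u := pow_succ u C.q'
  have h1 : 8 * ((fatWait e.fat : ℝ) + R e.step + 1) * ((L : ℝ) * R e.step) ^ C.q' ≤
      24 * D * (u ^ C.q' * u) := by
    calc 8 * ((fatWait e.fat : ℝ) + R e.step + 1) * ((L : ℝ) * R e.step) ^ C.q'
        ≤ 8 * (3 * D * u) * u ^ C.q' := mul_le_mul (by linarith) hp (by positivity) (by positivity)
      _ = 24 * D * (u ^ C.q' * u) := by ring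
  have h2 : 8 * (C.E₃ / C.E₂) * (((L : ℝ) * R e.step) ^ C.q' * D) ≤ 8 * (C.E₃ / C.E₂) * D * (u ^ C.q' * u) := by
    have : ((L : ℝ) * R e.step) ^ C.q' * D ≤ (u ^ C.q' * u) * D :=
      mul_le_mul_of_nonneg_right (hp.trans (le_mul_of_one_le_right hq0 hu)) (by linarith)
    nlinarith
  have h3 : 4 * ((fatWait e.fat : ℝ) + R e.step + 1) ≤ 12 * D * (u ^ C.q' * u) := by
    have hq1' : 1 ≤ u ^ C.q' * u := by nlinarith
    nlinarith
  rw [hpow]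
  nlinarith

/-- **A RENEWAL'S SHARE AGAINST A SIZE BOUND**: for a kind-`1` event at step `s` with `R_s ≤ u`, `L·R_s ≤ u`, `u ≥ 1`:
`dshare C L R e ≤ 24·u^{q′+1}`. [folklore] -/
theorem dshare_kind1_le_of_size_le {u : ℝ} (hu : 1 ≤ u) {e : PEv} (h : e.kind = 1)
    (hRs : (R e.step : ℝ) ≤ u) (hLRs : (L : ℝ) * R e.step ≤ u) :
    dshare C L R e ≤ 24 * u ^ (C.q' + 1) := by
  rw [dshare_kind1_eq h]
  have hu0 : 0 ≤ u := by linarith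
  have hRs0 : (0 : ℝ) ≤ R e.step := Nat.cast_nonneg _
  have hp : ((L : ℝ) * R e.step) ^ C.q' ≤ u ^ C.q' := pow_le_pow_left₀ (by positivity) hLRs _
  have hq1 : 1 ≤ u ^ C.q' := one_le_pow₀ hu
  have hq0 : 0 ≤ u ^ C.q' := by positivity
  have hpow : u ^ (C.q' + 1) = u ^ C.q' * u := pow_succ u C.q'
  have h1 : 8 * ((R e.step : ℝ) + 1) * ((L : ℝ) * R e.step) ^ C.q' ≤ 16 * (u ^ C.q' * u) := by
    calc 8 * ((R e.step : ℝ) + 1) * ((L : ℝ) * R e.step) ^ C.q'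
        ≤ 8 * (2 * u) * u ^ C.q' := mul_le_mul (by linarith) hp (by positivity) (by positivity)
      _ = 16 * (u ^ C.q' * u) := by ring
  have h3 : 4 * ((R e.step : ℝ) + 1) ≤ 8 * (u ^ C.q' * u) := by
    have hq1' : 1 ≤ u ^ C.q' * u := by nlinarith
    nlinarith
  rw [hpow]
  linarith

end Shares

/-! ## §3 The size envelope: (2.9)'s first member and the (2.5) envelope put every size a birth at `j` (or a renewal
by the level-`h` operation) ever reads below ONE letter `u_j = L³·ℓ_j^{r}` -/

section Sizes

variable {L K r : ℕ} {R : ℕ → ℕ} {g : ℕ → ℝ} {β' β₀ : ℝ}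

/-- the size envelope letter `u_j = L³·ℓ_j^{r}`. [folklore] -/
def uEnv (L r : ℕ) (g : ℕ → ℝ) (j : ℕ) : ℝ := (L : ℝ) ^ 3 * ell g j ^ r

/-- **LATER SIZES** ((2.9), first member, `B14FlowStep.FlowIneq29`): `R_s ≤ L·R_j` for every `j ≤ s ≤ K` (`L ≥ 1`; at
`s = j` trivially) — the K-UNIFORMITY of `RoundingRoom.birth`'s «one merger share at any later performed step» (leaf-06
g31's X6 note `mshare_later_le`, leaf-05 g30's F69 (iii)). [folklore] -/
theorem size_later_le (h29 : B14FlowStep.FlowIneq29 R g L β' β₀ K) (hL : 1 ≤ L) {j s : ℕ} (hjs : j ≤ s)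
    (hsK : s ≤ K) : (R s : ℝ) ≤ L * R j := by
  rcases hjs.eq_or_lt with rfl | hlt
  · have hL1 : (1 : ℝ) ≤ L := by exact_mod_cast hL
    have hR0 : (0 : ℝ) ≤ R j := Nat.cast_nonneg _
    nlinarith
  · exact (h29 j s hlt hsK).1

/-- **THE ENVELOPE**: under the (2.5) envelope `R_j ≤ L·ℓ_j^{r}` (`B14FlowStep.isRj_le_mul_logpow`), `1 ≤ ℓ_j`, `L ≥ 1` and
(2.9), for `j ≤ s ≤ K`: `1 ≤ u_j`, `R_j ≤ u_j`, `L·R_j ≤ u_j`, `R_s ≤ u_j`, `L·R_s ≤ u_j`. [folklore] -/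
theorem sizes_le_uEnv (h29 : B14FlowStep.FlowIneq29 R g L β' β₀ K) (hL : 1 ≤ L) {j s : ℕ} (hjs : j ≤ s)
    (hsK : s ≤ K) (hRup : (R j : ℝ) ≤ L * ell g j ^ r) (hℓ : 1 ≤ ell g j) :
    1 ≤ uEnv L r g j ∧ (R j : ℝ) ≤ uEnv L r g j ∧ (L : ℝ) * R j ≤ uEnv L r g j ∧
      (R s : ℝ) ≤ uEnv L r g j ∧ (L : ℝ) * R s ≤ uEnv L r g j := by
  have hL1 : (1 : ℝ) ≤ L := by exact_mod_cast hL
  have hℓr : 1 ≤ ell g j ^ r := one_le_pow₀ hℓ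
  have hR0 : (0 : ℝ) ≤ R j := Nat.cast_nonneg _
  have hs := size_later_le h29 hL hjs hsK
  have hL2 : (L : ℝ) ≤ (L : ℝ) ^ 2 := by nlinarith
  have hL3 : (L : ℝ) ^ 2 ≤ (L : ℝ) ^ 3 := by nlinarith
  unfold uEnv
  refine ⟨?_, ?_, ?_, ?_, ?_⟩
  · nlinarith [one_le_pow₀ (M₀ := ℝ) (a := (L : ℝ)) hL1 (n := 3)]
  · calc (R j : ℝ) ≤ L * ell g j ^ r := hRup
      _ ≤ (L : ℝ) ^ 3 * ell g j ^ r := by nlinarith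
  · calc (L : ℝ) * R j ≤ L * (L * ell g j ^ r) := by nlinarith
      _ = (L : ℝ) ^ 2 * ell g j ^ r := by ring
      _ ≤ (L : ℝ) ^ 3 * ell g j ^ r := by nlinarith
  · calc (R s : ℝ) ≤ L * R j := hs
      _ ≤ L * (L * ell g j ^ r) := by nlinarith
      _ = (L : ℝ) ^ 2 * ell g j ^ r := by ring
      _ ≤ (L : ℝ) ^ 3 * ell g j ^ r := by nlinarith
  · calc (L : ℝ) * R s ≤ L * (L * R j) := by nlinarith
      _ ≤ L * (L * (L * ell g j ^ r)) := by nlinarith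
      _ = (L : ℝ) ^ 3 * ell g j ^ r := by ring

/-- `u_j^{q′+1} = L^{3(q′+1)}·ℓ_j^{r(q′+1)}`. [folklore] -/
theorem uEnv_pow (L r q : ℕ) (g : ℕ → ℝ) (j : ℕ) :
    uEnv L r g j ^ (q + 1) = (L : ℝ) ^ (3 * (q + 1)) * ell g j ^ (r * (q + 1)) := by
  unfold uEnv
  rw [mul_pow, ← pow_mul, ← pow_mul]

end Sizes

end

end Summit.QuantumFields.BalabanUV.T4Continuum.HistoryBankingSharpShares
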